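import Mathlib
import Summits.AtomisticToContinuum.HydrodynamicLimit.Theorems.ImplosionDichotomyDenseExcursionSonicCavityDefs

/-!
# Centre decay and exterior uniqueness of smooth radial modes (for `stub_realBound`; crux `DenseExcursion`,
# line `sonic-cavity-renewal`)

Helper file (`--supports stmt-AtomisticToContinuum-12586`) for the registered stub `stub_realBound` of the line
`sonic-cavity-renewal` (vocabulary `…SonicCavityDefs`, modes `…R2Modes`). Two facts about a smooth radial mode
`(Λ, ŵ, ŝ)` that do not involve the energy identity:

* `realBound_centre_decay` — CENTRE DECAY OF A REGULAR PAIR: if the fields `Re/Im ŵ(log‖y‖)·y`, `‖y‖·Re/Im ŝ(log‖y‖)`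
  extend continuously to `ℝ³` (`IsRegularPair`), then `‖ŵ x‖, ‖ŝ x‖ ≤ C e^{−x}` on `x ≤ 0` (restrict the four fields to
  the segment `{t e₀ : t ∈ [0, 1]}`, where they are bounded, and read them at `t = eˣ`);
* `realBound_unique_right` — EXTERIOR UNIQUENESS: a smooth radial mode of a monatomic profile in the cavity tube that
  vanishes on `x < 1` vanishes identically. On `x > 0` the tube's subsonic clause `W + S < 1` with `S > 0` gives
  `det A = (W − 1)² − S² > 0` for the principal matrix `A = [[W−1, 3S],[S/3, W−1]]`, so the mode equations are a linear
  ODE `v′ = A⁻¹(Λ − B)v` with continuous coefficients on every `[1/2, X]`; Grönwall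
  (`eq_zero_of_abs_deriv_le_mul_abs_self_of_eq_zero_right`) with `v(1/2) = 0` gives `v ≡ 0` there.

NOT here: the energy identity (`…SonicRealBoundEnergy`) and the stub (`…SonicRealBound`).
-/

noncomputable section

open Filter Set
open scoped Topology ContDiff

namespace Summit.AtomisticToContinuum.HydrodynamicLimit.Theorems.SonicCavityRenewal

open Summit.AtomisticToContinuum.HydrodynamicLimit.Theorems.R2OneModeTwoConditions
open Literature.MathematicalPhysics.KineticTheory (V3)
open Summit.AtomisticToContinuum.HydrodynamicLimit.Theorems.KidderKnobMelnikov (norm_smul_unitVec)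

/-! ## Centre decay of a regular pair -/

/-- **Helper `realBound_centre_decay` of `stub_realBound`: CENTRE DECAY OF A REGULAR PAIR.** If `(ŵ, ŝ)` is a regular
pair (the radial fields `Re/Im ŵ(log‖y‖)·y` and `‖y‖·Re/Im ŝ(log‖y‖)` extend to smooth fields on `ℝ³`), then there is
`C ≥ 0` with `‖ŵ x‖ ≤ C e^{−x}` and `‖ŝ x‖ ≤ C e^{−x}` for all `x ≤ 0`: the four fields are bounded on the unit segment
`t e₀`, `t ∈ [0, 1]`, and at `t = eˣ` they read `eˣ·(Re ŵ, Im ŵ, Re ŝ, Im ŝ)(x)` in norm. -/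
theorem realBound_centre_decay : ∀ (ŵ ŝ : ℝ → ℂ), IsRegularPair ŵ ŝ →
    ∃ C : ℝ, 0 ≤ C ∧ ∀ x, x ≤ 0 → ‖ŵ x‖ ≤ C * Real.exp (-x) ∧ ‖ŝ x‖ ≤ C * Real.exp (-x) := by
  intro ŵ ŝ hreg
  obtain ⟨-, -, F₁, F₂, G₁, G₂, hF₁, hF₂, hG₁, hG₂, hFG⟩ := hreg
  set e₀ : V3 := EuclideanSpace.single 0 1 with he₀
  set g : ℝ → ℝ := fun t => ‖F₁ (t • e₀)‖ + ‖F₂ (t • e₀)‖ + ‖G₁ (t • e₀)‖ + ‖G₂ (t • e₀)‖ with hg_def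
  have hl : Continuous fun t : ℝ => t • e₀ := continuous_id.smul continuous_const
  have hg : Continuous g :=
    (((hF₁.continuous.comp hl).norm.add (hF₂.continuous.comp hl).norm).add
      (hG₁.continuous.comp hl).norm).add (hG₂.continuous.comp hl).norm
  obtain ⟨C, hC⟩ := (isCompact_Icc : IsCompact (Icc (0 : ℝ) 1)).exists_bound_of_continuousOn hg.continuousOn
  have hC0 : 0 ≤ C := le_trans (norm_nonneg _) (hC 0 ⟨le_rfl, zero_le_one⟩)
  refine ⟨C, hC0, fun x hx => ?_⟩
  have ht : 0 < Real.exp x := Real.exp_pos x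
  have ht1 : Real.exp x ≤ 1 := Real.exp_le_one_iff.mpr hx
  have hnorm : ‖Real.exp x • e₀‖ = Real.exp x := norm_smul_unitVec ht.le
  have hy : Real.exp x • e₀ ≠ 0 := norm_pos_iff.1 (by rw [hnorm]; exact ht)
  obtain ⟨h1, h2, h3, h4⟩ := hFG _ hy
  rw [hnorm, Real.log_exp] at h1 h2 h3 h4
  have hgC := hC (Real.exp x) ⟨ht.le, ht1⟩
  have hgval : g (Real.exp x) = Real.exp x * (|(ŵ x).re| + |(ŵ x).im| + |(ŝ x).re| + |(ŝ x).im|) := by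
    simp only [hg_def, ← h1, ← h2, ← h3, ← h4, norm_smul, hnorm, Real.norm_eq_abs, abs_mul, abs_of_pos ht]
    ring
  rw [Real.norm_of_nonneg (by positivity), hgval] at hgC
  have key : ∀ z : ℂ, Real.exp x * (|z.re| + |z.im|) ≤ C → ‖z‖ ≤ C * Real.exp (-x) := by
    intro z hz
    have h := Complex.norm_le_abs_re_add_abs_im z
    rw [Real.exp_neg, ← div_eq_mul_inv, le_div_iff₀ ht]
    nlinarith
  constructor
  · exact key (ŵ x) (by nlinarith [abs_nonneg (ŝ x).re, abs_nonneg (ŝ x).im])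
  · exact key (ŝ x) (by nlinarith [abs_nonneg (ŵ x).re, abs_nonneg (ŵ x).im])

/-! ## Exterior uniqueness (Grönwall on `[1/2, X]`) -/

/-- CRAMER for the principal part: from the two mode equations at a point, `det A · ŵ′` and `det A · ŝ′` are explicit
combinations of `p = Λŵ − (W′+2W−r)ŵ − (3S′+6S)ŝ` and `q = Λŝ − (S′+2S)ŵ − (W′/3+2W−r)ŝ`. -/
theorem mode_cramer {r : ℝ} {W S : ℝ → ℝ} {Λ : ℂ} {ŵ ŝ : ℝ → ℂ} {y : ℝ}
    (h₁ : Λ * ŵ y = linW r W S ŵ ŝ y) (h₂ : Λ * ŝ y = linS r W S ŵ ŝ y) :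
    (((W y - 1) ^ 2 - S y ^ 2 : ℝ) : ℂ) * deriv ŵ y =
        ((W y - 1 : ℝ) : ℂ) * (Λ * ŵ y - ((deriv W y + 2 * W y - r : ℝ) : ℂ) * ŵ y
            - ((3 * deriv S y + 6 * S y : ℝ) : ℂ) * ŝ y)
          - ((3 * S y : ℝ) : ℂ) * (Λ * ŝ y - ((deriv S y + 2 * S y : ℝ) : ℂ) * ŵ y
            - ((deriv W y / 3 + 2 * W y - r : ℝ) : ℂ) * ŝ y) ∧
      (((W y - 1) ^ 2 - S y ^ 2 : ℝ) : ℂ) * deriv ŝ y =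
        ((W y - 1 : ℝ) : ℂ) * (Λ * ŝ y - ((deriv S y + 2 * S y : ℝ) : ℂ) * ŵ y
            - ((deriv W y / 3 + 2 * W y - r : ℝ) : ℂ) * ŝ y)
          - ((S y / 3 : ℝ) : ℂ) * (Λ * ŵ y - ((deriv W y + 2 * W y - r : ℝ) : ℂ) * ŵ y
            - ((3 * deriv S y + 6 * S y : ℝ) : ℂ) * ŝ y) := by
  have hdet : (((W y - 1) ^ 2 - S y ^ 2 : ℝ) : ℂ) =
      ((W y - 1 : ℝ) : ℂ) * ((W y - 1 : ℝ) : ℂ) - ((3 * S y : ℝ) : ℂ) * ((S y / 3 : ℝ) : ℂ) := by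
    push_cast; ring
  simp only [linW, linS] at h₁ h₂
  rw [hdet]
  constructor
  · linear_combination (-((W y - 1 : ℝ) : ℂ)) * h₁ + ((3 * S y : ℝ) : ℂ) * h₂
  · linear_combination (-((W y - 1 : ℝ) : ℂ)) * h₂ + ((S y / 3 : ℝ) : ℂ) * h₁

/-- NORM FORM OF CRAMER: with `n = max(‖ŵ‖, ‖ŝ‖)` and the continuous majorant
`M = (|W−1| + 3|S|)(‖Λ‖ + |W′+2W−r| + |3S′+6S| + |S′+2S| + |W′/3+2W−r|)`, both `det A·‖ŵ′‖` and `det A·‖ŝ′‖` are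
`≤ M·n` wherever `det A = (W−1)² − S² > 0`. -/
theorem mode_deriv_norm_le {r : ℝ} {W S : ℝ → ℝ} {Λ : ℂ} {ŵ ŝ : ℝ → ℂ} {y : ℝ}
    (h₁ : Λ * ŵ y = linW r W S ŵ ŝ y) (h₂ : Λ * ŝ y = linS r W S ŵ ŝ y) (hdet : 0 < (W y - 1) ^ 2 - S y ^ 2) :
    ‖(deriv ŵ y, deriv ŝ y)‖ ≤
      (|W y - 1| + 3 * |S y|) * (‖Λ‖ + |deriv W y + 2 * W y - r| + |3 * deriv S y + 6 * S y|
          + |deriv S y + 2 * S y| + |deriv W y / 3 + 2 * W y - r|) / ((W y - 1) ^ 2 - S y ^ 2)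
        * ‖(ŵ y, ŝ y)‖ := by
  obtain ⟨e₁, e₂⟩ := mode_cramer h₁ h₂
  set n : ℝ := ‖(ŵ y, ŝ y)‖ with hn
  have hŵn : ‖ŵ y‖ ≤ n := norm_fst_le (ŵ y, ŝ y)
  have hŝn : ‖ŝ y‖ ≤ n := norm_snd_le (ŵ y, ŝ y)
  have hn0 : 0 ≤ n := norm_nonneg _
  set c₃ : ℝ := deriv W y + 2 * W y - r
  set c₄ : ℝ := 3 * deriv S y + 6 * S y
  set c₅ : ℝ := deriv S y + 2 * S y
  set c₆ : ℝ := deriv W y / 3 + 2 * W y - r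
  set m : ℝ := ‖Λ‖ + |c₃| + |c₄| + |c₅| + |c₆| with hm
  have hm0 : ‖Λ‖ ≤ m := by
    have h3 := abs_nonneg c₃; have h4 := abs_nonneg c₄; have h5 := abs_nonneg c₅; have h6 := abs_nonneg c₆
    linarith
  -- norms of `p` and `q`
  have hp : ‖Λ * ŵ y - (c₃ : ℂ) * ŵ y - (c₄ : ℂ) * ŝ y‖ ≤ m * n := by
    calc ‖Λ * ŵ y - (c₃ : ℂ) * ŵ y - (c₄ : ℂ) * ŝ y‖
        ≤ ‖Λ * ŵ y‖ + ‖(c₃ : ℂ) * ŵ y‖ + ‖(c₄ : ℂ) * ŝ y‖ := norm_sub_le_of_le (norm_sub_le _ _) le_rfl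
      _ = ‖Λ‖ * ‖ŵ y‖ + |c₃| * ‖ŵ y‖ + |c₄| * ‖ŝ y‖ := by
        simp only [norm_mul, Complex.norm_real, Real.norm_eq_abs]
      _ ≤ ‖Λ‖ * n + |c₃| * n + |c₄| * n := by gcongr
      _ ≤ m * n := by
        have := abs_nonneg c₅; have := abs_nonneg c₆
        nlinarith [mul_nonneg (abs_nonneg c₅) hn0, mul_nonneg (abs_nonneg c₆) hn0]
  have hq : ‖Λ * ŝ y - (c₅ : ℂ) * ŵ y - (c₆ : ℂ) * ŝ y‖ ≤ m * n := by
    calc ‖Λ * ŝ y - (c₅ : ℂ) * ŵ y - (c₆ : ℂ) * ŝ y‖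
        ≤ ‖Λ * ŝ y‖ + ‖(c₅ : ℂ) * ŵ y‖ + ‖(c₆ : ℂ) * ŝ y‖ := norm_sub_le_of_le (norm_sub_le _ _) le_rfl
      _ = ‖Λ‖ * ‖ŝ y‖ + |c₅| * ‖ŵ y‖ + |c₆| * ‖ŝ y‖ := by
        simp only [norm_mul, Complex.norm_real, Real.norm_eq_abs]
      _ ≤ ‖Λ‖ * n + |c₅| * n + |c₆| * n := by gcongr
      _ ≤ m * n := by
        nlinarith [mul_nonneg (abs_nonneg c₃) hn0, mul_nonneg (abs_nonneg c₄) hn0]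
  -- the two derivative bounds
  set D : ℝ := (W y - 1) ^ 2 - S y ^ 2 with hD
  have hDn : ‖((D : ℝ) : ℂ)‖ = D := by rw [Complex.norm_real, Real.norm_of_nonneg hdet.le]
  have hw' : D * ‖deriv ŵ y‖ ≤ (|W y - 1| + 3 * |S y|) * m * n := by
    have h := congrArg (fun z : ℂ => ‖z‖) e₁
    simp only [norm_mul, hDn] at h
    rw [h]
    calc _ ≤ ‖((W y - 1 : ℝ) : ℂ) * (Λ * ŵ y - (c₃ : ℂ) * ŵ y - (c₄ : ℂ) * ŝ y)‖
          + ‖((3 * S y : ℝ) : ℂ) * (Λ * ŝ y - (c₅ : ℂ) * ŵ y - (c₆ : ℂ) * ŝ y)‖ := norm_sub_le _ _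
      _ = |W y - 1| * ‖Λ * ŵ y - (c₃ : ℂ) * ŵ y - (c₄ : ℂ) * ŝ y‖
          + 3 * |S y| * ‖Λ * ŝ y - (c₅ : ℂ) * ŵ y - (c₆ : ℂ) * ŝ y‖ := by
        rw [norm_mul, norm_mul, Complex.norm_real, Complex.norm_real, Real.norm_eq_abs, Real.norm_eq_abs,
          abs_mul, abs_of_nonneg (by norm_num : (0 : ℝ) ≤ 3)]
      _ ≤ |W y - 1| * (m * n) + 3 * |S y| * (m * n) := by gcongr
      _ = (|W y - 1| + 3 * |S y|) * m * n := by ring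
  have hs' : D * ‖deriv ŝ y‖ ≤ (|W y - 1| + 3 * |S y|) * m * n := by
    have h := congrArg (fun z : ℂ => ‖z‖) e₂
    simp only [norm_mul, hDn] at h
    rw [h]
    calc _ ≤ ‖((W y - 1 : ℝ) : ℂ) * (Λ * ŝ y - (c₅ : ℂ) * ŵ y - (c₆ : ℂ) * ŝ y)‖
          + ‖((S y / 3 : ℝ) : ℂ) * (Λ * ŵ y - (c₃ : ℂ) * ŵ y - (c₄ : ℂ) * ŝ y)‖ := norm_sub_le _ _
      _ = |W y - 1| * ‖Λ * ŝ y - (c₅ : ℂ) * ŵ y - (c₆ : ℂ) * ŝ y‖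
          + |S y| / 3 * ‖Λ * ŵ y - (c₃ : ℂ) * ŵ y - (c₄ : ℂ) * ŝ y‖ := by
        rw [norm_mul, norm_mul, Complex.norm_real, Complex.norm_real, Real.norm_eq_abs, Real.norm_eq_abs,
          abs_div, abs_of_nonneg (by norm_num : (0 : ℝ) ≤ 3)]
      _ ≤ |W y - 1| * (m * n) + |S y| / 3 * (m * n) := by gcongr
      _ ≤ (|W y - 1| + 3 * |S y|) * m * n := by
        have : 0 ≤ |S y| * (m * n) := mul_nonneg (abs_nonneg _) (mul_nonneg (le_trans (norm_nonneg _) hm0) hn0)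
        nlinarith
  -- assemble
  rw [Prod.norm_mk, max_le_iff, div_mul_eq_mul_div, le_div_iff₀ hdet, le_div_iff₀ hdet]
  constructor
  · calc ‖deriv ŵ y‖ * ((W y - 1) ^ 2 - S y ^ 2) = D * ‖deriv ŵ y‖ := by rw [hD]; ring
      _ ≤ _ := hw'
      _ = _ := by ring
  · calc ‖deriv ŝ y‖ * ((W y - 1) ^ 2 - S y ^ 2) = D * ‖deriv ŝ y‖ := by rw [hD]; ring
      _ ≤ _ := hs'
      _ = _ := by ring

/-- **Helper `realBound_unique_right` of `stub_realBound`: EXTERIOR UNIQUENESS OF SMOOTH RADIAL MODES.** For a monatomic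
profile in the cavity tube, a smooth radial mode that vanishes on `x < 1` vanishes everywhere: on `[1/2, X]` the
principal matrix is invertible (`(W−1)² − S² > 0` from `W + S < 1`, `S > 0` on `x > 0`), the mode equations are a
linear ODE with coefficients continuous on the compact interval, hence bounded by `K‖v‖`, and Grönwall with
`v(1/2) = 0` forces `v = 0`. -/
theorem realBound_unique_right : ∀ (r : ℝ) (W S : ℝ → ℝ) (Λ : ℂ) (ŵ ŝ : ℝ → ℂ), IsMonatomicProfile r W S →
    CavityTube r W S → IsSmoothRadialMode r W S Λ ŵ ŝ → (∀ x, x < 1 → ŵ x = 0 ∧ ŝ x = 0) →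
    ∀ x, ŵ x = 0 ∧ ŝ x = 0 := by
  intro r W S Λ ŵ ŝ hP hT hm hleft x
  rcases lt_or_ge x 1 with hx | hx
  · exact hleft x hx
  obtain ⟨-, -, hW, hS, hSpos, -⟩ := hP
  obtain ⟨-, -, hsub, -⟩ := hT
  obtain ⟨⟨hŵ, hŝ, -⟩, -, hmode⟩ := hm
  have hW0 : Continuous W := hW.continuous
  have hS0 : Continuous S := hS.continuous
  have hW1 : Continuous (deriv W) := hW.continuous_deriv (by simp)
  have hS1 : Continuous (deriv S) := hS.continuous_deriv (by simp)
  have hŵ1 : Differentiable ℝ ŵ := hŵ.differentiable (by simp)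
  have hŝ1 : Differentiable ℝ ŝ := hŝ.differentiable (by simp)
  have hdet_pos : ∀ y, 0 < y → 0 < (W y - 1) ^ 2 - S y ^ 2 := by
    intro y hy
    have h1 := hsub y hy
    have h2 := hSpos y
    nlinarith
  -- a positive lower bound `d` for the determinant on `[1/2, x]`
  have hdet_cont : Continuous fun y => (W y - 1) ^ 2 - S y ^ 2 := by fun_prop
  obtain ⟨y₀, hy₀, hmin⟩ := (isCompact_Icc : IsCompact (Icc (1 / 2 : ℝ) x)).exists_isMinOn
    (nonempty_Icc.2 (by linarith)) hdet_cont.continuousOn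
  have hd : 0 < (W y₀ - 1) ^ 2 - S y₀ ^ 2 := hdet_pos y₀ (by linarith [hy₀.1])
  -- a bound `B` for the continuous majorant on `[1/2, x]`
  have hMc : Continuous fun y => (|W y - 1| + 3 * |S y|) * (‖Λ‖ + |deriv W y + 2 * W y - r|
      + |3 * deriv S y + 6 * S y| + |deriv S y + 2 * S y| + |deriv W y / 3 + 2 * W y - r|) := by
    fun_prop
  obtain ⟨B, hB⟩ := (isCompact_Icc : IsCompact (Icc (1 / 2 : ℝ) x)).exists_bound_of_continuousOn
    hMc.continuousOn
  -- Grönwall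
  have key := eq_zero_of_abs_deriv_le_mul_abs_self_of_eq_zero_right (f := fun y => (ŵ y, ŝ y))
    (f' := fun y => (deriv ŵ y, deriv ŝ y)) (K := B / ((W y₀ - 1) ^ 2 - S y₀ ^ 2)) (a := 1 / 2) (b := x)
    ?_ ?_ ?_ ?_ x ⟨by linarith, le_rfl⟩
  · simpa using key
  · exact ((hŵ1.continuous.prodMk hŝ1.continuous)).continuousOn
  · exact fun y _ => ((hŵ1 y).hasDerivAt.prodMk (hŝ1 y).hasDerivAt).hasDerivWithinAt
  · obtain ⟨h1, h2⟩ := hleft (1 / 2) (by norm_num)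
    exact Prod.ext h1 h2
  · intro y hy
    have hy0 : 0 < y := by linarith [hy.1]
    have hdet := hdet_pos y hy0
    have hyI : y ∈ Icc (1 / 2 : ℝ) x := ⟨hy.1, hy.2.le⟩
    have h := mode_deriv_norm_le (hmode y).1 (hmode y).2 hdet
    refine h.trans (mul_le_mul_of_nonneg_right ?_ (norm_nonneg _))
    have hBy := hB y hyI
    rw [Real.norm_of_nonneg (by positivity)] at hBy
    have hminy : (W y₀ - 1) ^ 2 - S y₀ ^ 2 ≤ (W y - 1) ^ 2 - S y ^ 2 := hmin hyI
    have hB0 : 0 ≤ B := le_trans (by positivity) hBy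
    calc _ ≤ B / ((W y - 1) ^ 2 - S y ^ 2) := by gcongr
      _ ≤ B / ((W y₀ - 1) ^ 2 - S y₀ ^ 2) := by gcongr

end Summit.AtomisticToContinuum.HydrodynamicLimit.Theorems.SonicCavityRenewal

end
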